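import Literature.AnabelianGeometry.EtaleTheta.SettingModelChiKummerData
import HarnessLib

/-!
# The χ-twisted root model of [EtTh] §1 (R78 (B)): NON-DEGENERACY of `log(U)`, `log(Ü)` in `KummerData.modelχ`

Mochizuki, *The étale theta function …*, Publ. RIMS **45** (2009) [EtTh], §1, Prop. 1.5, PRIMS PDF p. 23
[cite: MochizukiEtTh2009, Prop 1.5 p.23]: `log(U)`, `log(Ü)` are the Kummer classes of the coordinate `U`, resp. `Ü` —
non-trivial classes (they generate, with `log(Θ)` / the Kummer image, the groups `F¹/F²`, `F̈¹/F̈²`).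

PROOF-ONLY sequel of `SettingModelChiKummerData.lean` (abc-iut cell, R78 F6 (c), seat abc-iut-w5-d171): at the
χ-twisted root model the classes `logUχ`, `logUddχ` of the `y`-coordinate cocycles are NOT trivial —
`SettingModel.logUχ_ne_one`, `SettingModel.logUddχ_ne_one`: a principal crossed homomorphism vanishes on the image of
`Δ^tp_X` (which centralises `Δ_Θ`), but the cocycles take the value `c`, resp. `c` (`= c^{2/2}`), at the geometric
element `b ∈ Δ^tp_Y`, resp. `b² ∈ Δ^tp_Ÿ`.  So `KummerData.modelχ` is inhabited by NON-DEGENERATE coordinate classes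
(consistency evidence for the typed interface; semi-synthetic model; nothing of [EtTh] asserted; no side taken on
[IUTchIII] Cor. 3.12).
-/

noncomputable section

open Topology

namespace Literature.AnabelianGeometry.EtaleTheta.SettingModel

open Literature.AnabelianGeometry.SemiGraphs

variable (p : ℕ) [Fact p.Prime]

/-- The geometric elements `(b^t, 0) ⋊ 1` lie in `Π^tp_Y = Ker(Π^tp_X ↠ ℤ)`. [cite: MochizukiEtTh2009, §1 p.13] -/
theorem inl_bPowGfp_mem_gtpY (t : ZH) :
    (SemidirectProduct.inl (bPowGfp t) : PiTpχ p) ∈ (ThetaSetting.modelχ p).GtpY := by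
  show (chiTwistData p).toZ _ = 1
  rw [GfpTwistData.toZ_apply, SemidirectProduct.left_inl, gfpSnd_bPowGfp]

/-- `(b², 0) ⋊ 1 ∈ Π^tp_Ÿ` (its level-`2` `y`-coordinate vanishes and its Galois part is trivial).
[cite: MochizukiEtTh2009, §1 p.17] -/
theorem inl_bPowGfp_two_mem_gtpYdd :
    (SemidirectProduct.inl (bPowGfp (iotaZ (Multiplicative.ofAdd 2))) : PiTpχ p) ∈ (ThetaSetting.modelχ p).GtpYdd := by
  refine Subgroup.mem_inf.mpr ⟨?_, ?_⟩
  · show (SemidirectProduct.inl (bPowGfp (iotaZ (Multiplicative.ofAdd 2))) : PiTpχ p) ∈ YNχ p (2 * 1)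
    rw [mul_one]
    refine (GfpTwistData.mem_YN _).mpr ⟨?_, by rw [SemidirectProduct.right_inl]; exact Subgroup.one_mem _⟩
    rw [SemidirectProduct.left_inl]
    refine Subgroup.mem_inf.mpr ⟨gfpSnd_bPowGfp _, ?_⟩
    refine Subgroup.mem_comap.mpr ⟨levelHom_x_eq_zero (gfpSnd_bPowGfp _), ?_⟩
    show (hHat 2 (bPow (iotaZ (Multiplicative.ofAdd 2)))).y = 0
    rw [hHat_y_eq_zero_iff, eHatB_bPow, modN_iotaZ, toAdd_ofAdd]
    have h2 : ((2 : ℤ) : ZMod (2 : ℕ+)) = 0 := by decide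
    rw [h2, ofAdd_zero]
  · rw [Subgroup.mem_comap]
    have : (ThetaSetting.modelχ p).aug.toMonoidHom
        (SemidirectProduct.inl (bPowGfp (iotaZ (Multiplicative.ofAdd 2))) : PiTpχ p) = 1 :=
      rfl
    rw [this]
    exact Subgroup.one_mem _

/-- The image of `Δ^tp_X` centralises `Δ_Θ`: conjugation by `toTheta x`, `x.right = 1`, is trivial on `Δ_Θ(modelχ)`.
[cite: MochizukiEtTh2009, §1 p.12] -/
theorem conjNormal_toTheta_eq_self {x : PiTpχ p} (hx : x.right = 1) (a : (ThetaSetting.modelχ p).DeltaTheta) :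
    MulAut.conjNormal (CurveTheta.toTheta (curveχ p) x) a = a := by
  apply Subtype.ext
  rw [MulAut.conjNormal_apply]
  have hy : CurveTheta.toTheta (curveχ p) x ∈ ((ThetaSetting.modelχ p).aug.toMonoidHom.ker).map (ThetaSetting.modelχ p).toTheta :=
    ⟨x, hx, rfl⟩
  rw [← (ThetaSetting.modelχ p).ker_thetaToEll_central a a.2 _ hy, mul_inv_cancel_right]

/-- The `y`-coordinate of `(b^t, 0) ⋊ 1` is `t`. [cite: MochizukiEtTh2009, Prop 1.5 p.23] -/
theorem yCoordχ_inl_bPowGfp (t : ZH) : yCoordχ p (SemidirectProduct.inl (bPowGfp t)) = t := by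
  show eHatB (gfpFst (SemidirectProduct.inl (bPowGfp t) : PiTpχ p).left) = t
  rw [SemidirectProduct.left_inl]
  exact eHatB_bPow t

/-- `ι 1 ≠ 1`, `ι 2 ≠ 1` in `Ẑ`. [cite: RibesZalesskii2010, Thm 2.7.1] -/
theorem iotaZ_ofAdd_ne_one {k : ℤ} (hk : k ≠ 0) : iotaZ (Multiplicative.ofAdd k) ≠ 1 := by
  intro h
  rw [← map_one iotaZ] at h
  have := iotaZ_injective h
  exact hk (by simpa using this)

/-- **`log(U) ≠ 0` at the χ-model.** [cite: MochizukiEtTh2009, Prop 1.5 p.23] -/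
theorem logUχ_ne_one : logUχ p ≠ 1 := by
  intro h
  rw [logUχ, ← ContH1.mk_one] at h
  obtain ⟨a, ha⟩ := (ContH1.mk_eq_mk_iff _ _ _ _ _).mp h
  set x : PiTpχ p := SemidirectProduct.inl (bPowGfp (iotaZ (Multiplicative.ofAdd 1))) with hxdef
  have hx : CurveTheta.toTheta (curveχ p) x ∈ (ThetaSetting.modelχ p).GtpY.map (ThetaSetting.modelχ p).toTheta :=
    ⟨x, inl_bPowGfp_mem_gtpY p _, rfl⟩
  have h1 := ha ⟨_, hx⟩
  rw [Pi.one_apply, mul_one, MonoidHom.id_apply] at h1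
  have hc := conjNormal_toTheta_eq_self p (x := x) (SemidirectProduct.right_inl _) a
  have hcoe : ((⟨_, hx⟩ : ↥((ThetaSetting.modelχ p).GtpY.map (ThetaSetting.modelχ p).toTheta)) :
      (ThetaSetting.modelχ p).GtpTheta) = CurveTheta.toTheta (curveχ p) x := rfl
  rw [hcoe, hc, mul_inv_cancel, inv_eq_one] at h1
  -- h1 : logUFunχ p _ ⟨toTheta x, hx⟩ = 1, i.e. `c^{ŷ(x)} = 1` with `ŷ(x) = ι 1`
  have h2 : deltaThetaCoordχ p (iotaZ (Multiplicative.ofAdd 1)) = 1 := by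
    rw [← yCoordχ_inl_bPowGfp p (iotaZ (Multiplicative.ofAdd 1))]
    exact h1
  have h3 := (bijective_deltaThetaCoordχ p).1 (h2.trans (map_one (deltaThetaCoordχ p)).symm)
  exact iotaZ_ofAdd_ne_one one_ne_zero h3

/-- **`log(Ü) ≠ 0` at the χ-model.** [cite: MochizukiEtTh2009, Prop 1.5 p.23] -/
theorem logUddχ_ne_one : logUddχ p ≠ 1 := by
  intro h
  rw [logUddχ, ← ContH1.mk_one] at h
  obtain ⟨a, ha⟩ := (ContH1.mk_eq_mk_iff _ _ _ _ _).mp h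
  set x : PiTpχ p := SemidirectProduct.inl (bPowGfp (iotaZ (Multiplicative.ofAdd 2))) with hxdef
  have hx : CurveTheta.toTheta (curveχ p) x ∈ (ThetaSetting.modelχ p).GtpYdd.map (ThetaSetting.modelχ p).toTheta :=
    ⟨x, inl_bPowGfp_two_mem_gtpYdd p, rfl⟩
  have h1 := ha ⟨_, hx⟩
  rw [Pi.one_apply, mul_one, MonoidHom.id_apply] at h1
  have hc := conjNormal_toTheta_eq_self p (x := x) (SemidirectProduct.right_inl _) a
  have hcoe : ((⟨_, hx⟩ : ↥((ThetaSetting.modelχ p).GtpYdd.map (ThetaSetting.modelχ p).toTheta)) :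
      (ThetaSetting.modelχ p).GtpTheta) = CurveTheta.toTheta (curveχ p) x := rfl
  rw [hcoe, hc, mul_inv_cancel, inv_eq_one] at h1
  -- h1 : c^{half ŷ(x)} = 1 ⇒ half (ι 2) = 1 ⇒ ι 2 = 1
  have h2 : half ⟨yThetaχ p (CurveTheta.toTheta (curveχ p) x), yThetaχ_mem_range_sqHom p hx⟩ = 1 :=
    (bijective_deltaThetaCoordχ p).1 (h1.trans (map_one (deltaThetaCoordχ p)).symm)
  have h3 := half_sq ⟨yThetaχ p (CurveTheta.toTheta (curveχ p) x), yThetaχ_mem_range_sqHom p hx⟩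
  rw [h2, one_pow] at h3
  -- h3 : 1 = ŷ(x) = ι 2
  have h4 : yThetaχ p (CurveTheta.toTheta (curveχ p) x) = iotaZ (Multiplicative.ofAdd 2) := by
    rw [yThetaχ_toTheta]
    exact yCoordχ_inl_bPowGfp p _
  exact iotaZ_ofAdd_ne_one two_ne_zero (h4.symm.trans h3.symm)

/-- Hence the Kummer data of the χ-model carry NON-TRIVIAL coordinate classes. [cite: MochizukiEtTh2009, Prop 1.5 p.23] -/
theorem kummerDataχ_logU_ne_one : (kummerDataχ p).logU ≠ 1 := logUχ_ne_one p

/-- [cite: MochizukiEtTh2009, Prop 1.5 p.23] -/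
theorem kummerDataχ_logUdd_ne_one : (kummerDataχ p).logUdd ≠ 1 := logUddχ_ne_one p

/-! ### `log(U)` restricts trivially to `Δ_Θ` (appended 2026-08-26, same seat) -/

open scoped commutatorElement

/-- `ê_b([a,b]^t) = 1`: commutator powers have trivial `b`-exponent (`y`-coordinate). [cite: MochizukiEtTh2009, §1 p.12] -/
theorem eHatB_powHat_commutator (t : ZH) :
    eHatB (powHat (eta ⁅FreeGroup.of (0 : Fin 2), FreeGroup.of 1⁆) t) = 1 := by
  have h := Literature.AnabelianGeometry.AbsoluteAnabelian.ZHatCompletion.monoidHom_ext_of_continuous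
    (f₁ := eHatB.toMonoidHom.comp (powHat (eta ⁅FreeGroup.of (0 : Fin 2), FreeGroup.of 1⁆)).toMonoidHom)
    (f₂ := (1 : ZH →* ZH))
    (eHatB.continuous.comp (powHat _).continuous) continuous_const (by
      change eHatB (powHat _ (iotaZ (Multiplicative.ofAdd 1))) = 1
      rw [powHat_iotaZ_one, eHatB_eta, map_commutatorElement, commutatorElement_eq_one_iff_commute.mpr
        (Commute.all _ _), map_one])
  exact DFunLike.congr_fun h t

/-- The `y`-coordinate vanishes on `Δ_Θ`: `ŷ(c^t) = 1`. [cite: MochizukiEtTh2009, Prop 1.5 p.23] -/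
theorem yThetaχ_cThetaχ (t : ZH) : yThetaχ p (cThetaχ p t) = 1 := by
  rw [cThetaχ_apply, yThetaχ_toTheta]
  show eHatB (gfpFst (SemidirectProduct.inl (cGfpχ t) : PiTpχ p).left) = 1
  rw [SemidirectProduct.left_inl, gfpFst_cGfpχ]
  exact eHatB_powHat_commutator t

/-- `Δ_Θ ≤ (Π^tp_Y)^Θ` at the χ-model (`c^t = inl(c^t, 0)` has degree `0`). [cite: MochizukiEtTh2009, §1 p.13] -/
theorem deltaTheta_le_gtpY_map_modelχ :
    (ThetaSetting.modelχ p).DeltaTheta ≤ (ThetaSetting.modelχ p).GtpY.map (ThetaSetting.modelχ p).toTheta := by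
  intro d hd
  obtain ⟨t, rfl⟩ := exists_cThetaχ_eq_of_mem_ker p hd
  refine ⟨SemidirectProduct.inl (cGfpχ t), ?_, (cThetaχ_apply p t).symm⟩
  show (chiTwistData p).toZ _ = 1
  rw [GfpTwistData.toZ_apply, SemidirectProduct.left_inl]
  rfl

/-- **`log(U)|_{Δ_Θ} = 0`** at the χ-model: the `y`-coordinate class restricts trivially to the centre `Δ_Θ`
(it is "orthogonal" to `log(Θ)`, which restricts to the identity there). [cite: MochizukiEtTh2009, Prop 1.5 p.23] -/
theorem res_deltaTheta_logUχ :
    ContH1.res (MonoidHom.id (ThetaSetting.modelχ p).GtpTheta) (ThetaSetting.modelχ p).DeltaTheta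
      (deltaTheta_le_gtpY_map_modelχ p) (logUχ p) = 1 := by
  rw [logUχ, ← ContH1.mk_one]
  refine ContH1.mk_congr _ (funext fun d => ?_) _ _
  obtain ⟨t, ht⟩ := exists_cThetaχ_eq_of_mem_ker p d.2
  show deltaThetaCoordχ p (yThetaχ p (d : (ThetaSetting.modelχ p).GtpTheta)) = 1
  rw [← ht, yThetaχ_cThetaχ, map_one]

end Literature.AnabelianGeometry.EtaleTheta.SettingModel

end
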